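/-
Copyright (c) 2026. All rights reserved.
Released under Apache 2.0 license as described in the file LICENSE.
-/
import Summits.Langlands.Langlands.Theorems.SoloInformedRepairD2CrisOrbit
import Summits.Langlands.Langlands.Theorems.SoloInformedRepairD2CrisCyclicCharpoly
import Mathlib.LinearAlgebra.Eigenspace.Triangularizable
import Mathlib.RingTheory.Flat.Basic
import HarnessLib

/-!
# `charpoly (φ_D^f | D_cris(ρ_v)) = charpoly (φ_D^f | D_c)^f`, conditional on injectivity of `φ`

Fifth and last proof-side rung of the D2-cris repair (`SoloInformedRepairD2Cris.lean` §4, clause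
`CrystallineCompatibleAt`: `charpoly (φ_D^{f}) = P^{f}` on `D_cris(ρ|Γ_{K_v})`, `q_v = p^f`).  The previous rungs
(`…KzeroAction`, `…TeichMinpoly`, `…Orbit`) are unconditional; this one is CONDITIONAL on the single named input
`Function.Injective (phiDcris ρ_v)` — injectivity of `φ_D` on `D_cris(ρ_v)`, which follows (§2, by flatness of
`ℚ̄_p^m` over `ℚ_p`) from injectivity of `φ` on the constructed `B_max(F)`; the latter is a published fact
(Colmez) that the tree does not yet prove for its `B_max(F) = A_max[1/t]`, and it is carried here as an explicit
hypothesis, never as an axiom.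

* §0 (imported, `…D2CrisCyclicCharpoly`: abstract linear algebra over a field `E`).  For `M, φ ∈ End_E V`,
  `e : Fin f → E` injective with `(e i)^p = e (i+1)`, `∏ᵢ (X - e i)` annihilating `M`, `φ M = M^p φ`,
  `φ^f M = M φ^f` and `φ` injective: `charpoly (φ^f) = charpoly (φ^f | D_{e i})^f`, `dim V = f · dim D_{e i}`
  (`charpoly_pow_eq_pow_charpoly_restrict`, `finrank_eq_mul_finrank_eigenspace`).
* §1 (`D_cris(ρ_v)`, `q_F = p^f`).  For `a ∈ 𝒪_F` with `ā` of degree `f` over `𝔽_p` and an eigenpair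
  `M_a x = c x`: `Ψ_a = ∏_{i<f} (X - c^{p^i})` over `ℚ̄_p` (`map_teichMinpoly_eq_prod`), so §0 applies with
  `e i = c^{p^i}`: **`charpoly (φ_D^f) = charpoly (φ_D^f | D_c)^f`** and **`dim D_cris(ρ_v) = f · dim D_c`**
  granted `φ_D` injective (`charpoly_phiDcris_pow_eq_pow`, `finrank_Dcris_eq_mul`); packaged without the
  choice of `a, c` as `exists_charpoly_phiDcris_pow_eq_pow`.
* §2 `φ` injective on `B_max(F)` ⇒ `φ_D` injective on `D_cris(ρ_v)` (`phiDcris_injective_of_frobBmax_injective`).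

Meaning for the clause: the exponent `f = [K_{v,0} : ℚ_p]` in `CrystallineCompatibleAt` is automatic — the
`ℚ̄_p`-polynomial `charpoly (φ_D^f | D_cris(ρ_v))` is an `f`-th power as soon as `φ` is injective on `B_max(F)`,
and what the clause pins is its `f`-th root `charpoly (φ_D^f | D_c)` (degree `dim D_c = dim_{K₀} D_cris`),
to be compared with the Satake polynomial.  No new objects; no claim about `B_max(F)` itself is made.

References: Fontaine, *Le corps des périodes p-adiques*, Astérisque 223 (1994), Exp. III §1.3–1.5, Exp. VIII
§2.3.7; Colmez, Ann. of Math. 148 (1998), §III.2; Horn–Johnson, *Matrix Analysis* (2013), §0.9.2;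
Buzzard–Gee, LMS Lect. Notes 414 (2014), Conj. 3.2.2.
-/

noncomputable section

-- `AddCommGroup (Module.End ℚ̄_p D_cris)` needs three nested instance syntheses (End → submodule → tensor → pi).
set_option maxSynthPendingDepth 3

open scoped MatrixGroups TensorProduct ValuativeRel Polynomial
open Field IsLocalRing ValuativeRel Polynomial
open Literature.NumberTheory.GaloisRepresentations Literature.NumberTheory.PAdicHodge
open Literature.NumberTheory.GaloisRepresentations.IsNonarchimedeanLocalField

namespace Summit.Langlands.Langlands.Theorems

namespace D2Cris

open D2St

/-! ### §1 `D_cris(ρ_v)`: `charpoly (φ_D^f) = charpoly (φ_D^f | D_c)^f` granted `φ_D` injective -/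

variable {F : Type} [Field F] [ValuativeRel F] [TopologicalSpace F] [IsNonarchimedeanLocalField F]
  [CharZero F] {p : ℕ} [Fact p.Prime] [Fact (¬ IsUnit (p : maxUnramifiedCompletion F))]
  [CharP (IsLocalRing.ResidueField (maxUnramifiedCompletion F)) p] [Fact (¬ IsUnit (p : integerC F))]
  [IsAdicComplete (Ideal.span {(p : integerC F)}) (integerC F)] {m : ℕ}

section Dcris

variable {f : ℕ} (hq : residueFieldCard F = p ^ f)

omit [CharZero F] [IsAdicComplete (Ideal.span {(p : integerC F)}) (integerC F)]
  [Fact (¬ IsUnit (p : integerC F))] [Fact (¬ IsUnit (p : maxUnramifiedCompletion F))] in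
/-- `Ψ_a(c) = 0 ⇒ Ψ_a(c^{p^k}) = 0` in `ℚ̄_p`. [folklore] -/
theorem eval₂_teichMinpoly_pow_pow_eq_zero (a : 𝒪[F]) {c : PadicAlgCl p}
    (hc : (teichMinpoly hq a).eval₂ (zpToAlgCl p) c = 0) (k : ℕ) :
    (teichMinpoly hq a).eval₂ (zpToAlgCl p) (c ^ p ^ k) = 0 := by
  induction k with
  | zero => rwa [pow_zero, pow_one]
  | succ k ih =>
    rw [pow_succ, pow_mul]
    exact eval₂_teichMinpoly_pow_eq_zero hq a ih

include hq

/-- `c^{p^f} = c` for an eigenvalue `c` of `M_a` (`q_F = p^f`). [folklore] -/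
theorem pow_pow_eq_of_mulDcris_eq_smul (ρv : FramedRep (absoluteGaloisGroup F) (PadicAlgCl p) m) (a : 𝒪[F])
    {x : Dcris (F := F) (p := p) ρv} {c : PadicAlgCl p} (hx : mulDcris ρv a x = c • x) (hx0 : x ≠ 0) :
    c ^ p ^ f = c := by
  rw [← hq]
  exact pow_residueFieldCard_eq_of_mulDcris_eq_smul ρv a hx hx0

/-- **`Ψ_a = ∏_{i<f} (X - c^{p^i})` over `ℚ̄_p`** for `ā` of degree `f` and an eigenvalue `c` of `M_a`: the
Frobenius orbit of `c` consists of `f` distinct roots of the degree-`f` monic `Ψ_a`. [cite: FontaineAsterisque223VIII, §2.3.7] -/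
theorem map_teichMinpoly_eq_prod (ρv : FramedRep (absoluteGaloisGroup F) (PadicAlgCl p) m) {a : 𝒪[F]}
    (ha : ∀ i, 0 < i → i < f → resBar F a ^ p ^ i ≠ resBar F a) {x : Dcris (F := F) (p := p) ρv}
    {c : PadicAlgCl p} (hx : mulDcris ρv a x = c • x) (hx0 : x ≠ 0) :
    (teichMinpoly hq a).map (zpToAlgCl p) = ∏ i : Fin f, (X - C (c ^ p ^ (i : ℕ))) := by
  classical
  have hmon : ((teichMinpoly hq a).map (zpToAlgCl p)).Monic := (teichMinpoly_monic hq a).map _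
  have hdeg : ((teichMinpoly hq a).map (zpToAlgCl p)).natDegree = f := by
    rw [(teichMinpoly_monic hq a).natDegree_map, natDegree_teichMinpoly]
  have he : Function.Injective fun i : Fin f => c ^ p ^ (i : ℕ) :=
    injective_pow_pow (pow_pow_eq_of_mulDcris_eq_smul hq ρv a hx hx0)
      fun k hk hkf => pow_ne_of_mulDcris_eq_smul ρv hx hx0 (ha k hk hkf)
  set S : Finset (PadicAlgCl p) := Finset.univ.image fun i : Fin f => c ^ p ^ (i : ℕ) with hS
  have hScard : S.card = f := by
    rw [hS, Finset.card_image_of_injective _ he, Finset.card_univ, Fintype.card_fin]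
  have hsub : S.val ≤ ((teichMinpoly hq a).map (zpToAlgCl p)).roots := by
    refine (Multiset.le_iff_subset S.nodup).2 fun r (hr : r ∈ S) => ?_
    obtain ⟨i, -, rfl⟩ := Finset.mem_image.1 hr
    rw [Polynomial.mem_roots hmon.ne_zero, Polynomial.IsRoot.def, Polynomial.eval_map]
    exact eval₂_teichMinpoly_pow_pow_eq_zero hq a
      (eval₂_teichMinpoly_eq_zero_of_mulDcris_eq_smul hq ρv a hx hx0) i
  have hroots : S.val = ((teichMinpoly hq a).map (zpToAlgCl p)).roots :=
    Multiset.eq_of_le_of_card_le hsub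
      (by rw [Finset.card_val, hScard]; exact card_roots_teichMinpoly_le hq a)
  have hcard : Multiset.card ((teichMinpoly hq a).map (zpToAlgCl p)).roots =
      ((teichMinpoly hq a).map (zpToAlgCl p)).natDegree := by
    rw [← hroots, Finset.card_val, hScard, hdeg]
  rw [← prod_multiset_X_sub_C_of_monic_of_roots_card_eq hmon hcard, ← hroots, ← Finset.prod_eq_multiset_prod,
    hS, Finset.prod_image fun i _ j _ h => he h]

/-- **`∏_{i<f} (M_a - c^{p^i}) = 0` on `D_cris(ρ_v)`** (`ā` of degree `f`, `c` an eigenvalue of `M_a`). [cite: FontaineAsterisque223VIII, §2.3.7] -/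
theorem aeval_prod_mulDcris_eq_zero (ρv : FramedRep (absoluteGaloisGroup F) (PadicAlgCl p) m) {a : 𝒪[F]}
    (ha : ∀ i, 0 < i → i < f → resBar F a ^ p ^ i ≠ resBar F a) {x : Dcris (F := F) (p := p) ρv}
    {c : PadicAlgCl p} (hx : mulDcris ρv a x = c • x) (hx0 : x ≠ 0) :
    aeval (mulDcris ρv a) (∏ i : Fin f, (X - C (c ^ p ^ (i : ℕ)))) = 0 := by
  rw [← map_teichMinpoly_eq_prod hq ρv ha hx hx0, Polynomial.aeval_def, Polynomial.eval₂_map]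
  exact eval₂_teichMinpoly_mulDcris hq ρv a

/-- **`charpoly (φ_D^f | D_cris(ρ_v)) = charpoly (φ_D^f | D_c)^f`, CONDITIONAL on `φ_D` injective.**  Here
`q_F = p^f`, `a ∈ 𝒪_F` has residue of degree `f` over `𝔽_p`, `(c, x)` is an eigenpair of `M_a`, `D_c` its
eigenspace (a `φ_D^f`-stable `ℚ̄_p`-subspace — one `τ`-component of the `K₀ ⊗ ℚ̄_p`-module `D_cris`).  The
hypothesis `hφ` is the tree's missing input «`φ` is injective on `B_max`» transported to `D_cris` (§2).
[cite: FontaineAsterisque223VIII, §2.3.7] [cite: BuzzardGeeLMS2014, Conj. 3.2.2] -/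
theorem charpoly_phiDcris_pow_eq_pow (ρv : FramedRep (absoluteGaloisGroup F) (PadicAlgCl p) m)
    [Module.Finite (PadicAlgCl p) (Dcris (F := F) (p := p) ρv)] (hφ : Function.Injective (phiDcris ρv))
    {a : 𝒪[F]} (ha : ∀ i, 0 < i → i < f → resBar F a ^ p ^ i ≠ resBar F a)
    {x : Dcris (F := F) (p := p) ρv} {c : PadicAlgCl p} (hx : mulDcris ρv a x = c • x) (hx0 : x ≠ 0)
    (h : Set.MapsTo (phiDcris ρv ^ f) ((mulDcris ρv a).eigenspace c) ((mulDcris ρv a).eigenspace c)) :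
    (phiDcris ρv ^ f).charpoly = ((phiDcris ρv ^ f).restrict h).charpoly ^ f := by
  haveI : NeZero f := ⟨(pos_of_residueFieldCard_eq hq).ne'⟩
  have hcf := pow_pow_eq_of_mulDcris_eq_smul hq ρv a hx hx0
  exact charpoly_pow_eq_pow_charpoly_restrict (e := fun i : Fin f => c ^ p ^ (i : ℕ))
    (injective_pow_pow hcf fun k hk hkf => pow_ne_of_mulDcris_eq_smul ρv hx hx0 (ha k hk hkf))
    (pow_pow_fin_succ hcf) (aeval_prod_mulDcris_eq_zero hq ρv ha hx hx0) (phiDcris_comp_mulDcris ρv a)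
    (phiDcris_pow_comp_mulDcris_of_card ρv hq a) hφ ⟨0, by simp⟩ h

/-- **`dim_{ℚ̄_p} D_cris(ρ_v) = f · dim D_c`, CONDITIONAL on `φ_D` injective** (so `dim D_c = dim_{K₀} D_cris`).
[cite: FontaineAsterisque223VIII, §2.3.7] -/
theorem finrank_Dcris_eq_mul (ρv : FramedRep (absoluteGaloisGroup F) (PadicAlgCl p) m)
    [Module.Finite (PadicAlgCl p) (Dcris (F := F) (p := p) ρv)] (hφ : Function.Injective (phiDcris ρv))
    {a : 𝒪[F]} (ha : ∀ i, 0 < i → i < f → resBar F a ^ p ^ i ≠ resBar F a)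
    {x : Dcris (F := F) (p := p) ρv} {c : PadicAlgCl p} (hx : mulDcris ρv a x = c • x) (hx0 : x ≠ 0) :
    Module.finrank (PadicAlgCl p) (Dcris (F := F) (p := p) ρv) =
      f * Module.finrank (PadicAlgCl p) ((mulDcris ρv a).eigenspace c) := by
  haveI : NeZero f := ⟨(pos_of_residueFieldCard_eq hq).ne'⟩
  have hcf := pow_pow_eq_of_mulDcris_eq_smul hq ρv a hx hx0
  exact finrank_eq_mul_finrank_eigenspace (e := fun i : Fin f => c ^ p ^ (i : ℕ))
    (injective_pow_pow hcf fun k hk hkf => pow_ne_of_mulDcris_eq_smul ρv hx hx0 (ha k hk hkf))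
    (pow_pow_fin_succ hcf) (aeval_prod_mulDcris_eq_zero hq ρv ha hx hx0) (phiDcris_comp_mulDcris ρv a)
    (phiDcris_pow_comp_mulDcris_of_card ρv hq a) hφ ⟨0, by simp⟩

/-- **Packaged form**: if `q_F = p^f` and `φ_D` is injective on the finite-dimensional `D_cris(ρ_v)`, there is a
`φ_D^f`-stable `ℚ̄_p`-subspace `W ⊆ D_cris(ρ_v)` with `dim D_cris = f · dim W` and
`charpoly (φ_D^f) = charpoly (φ_D^f | W)^f` — the shape asserted by `CrystallineCompatibleAt`. (`W = D_c` for an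
eigenvalue `c` of `M_a`, `ā` a generator of `k_F^×`; `W = D_cris = 0` in the trivial case.)
[cite: FontaineAsterisque223VIII, §2.3.7] [cite: BuzzardGeeLMS2014, Conj. 3.2.2] -/
theorem exists_charpoly_phiDcris_pow_eq_pow (ρv : FramedRep (absoluteGaloisGroup F) (PadicAlgCl p) m)
    [Module.Finite (PadicAlgCl p) (Dcris (F := F) (p := p) ρv)] (hφ : Function.Injective (phiDcris ρv)) :
    ∃ (W : Submodule (PadicAlgCl p) (Dcris (F := F) (p := p) ρv))
      (hW : Set.MapsTo (phiDcris ρv ^ f) W W),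
      Module.finrank (PadicAlgCl p) (Dcris (F := F) (p := p) ρv) = f * Module.finrank (PadicAlgCl p) W ∧
        (phiDcris ρv ^ f).charpoly = ((phiDcris ρv ^ f).restrict hW).charpoly ^ f := by
  obtain ⟨a, -, ha⟩ := exists_resBar_pow_ne hq
  rcases subsingleton_or_nontrivial (Dcris (F := F) (p := p) ρv) with hs | hn
  · refine ⟨⊤, fun x _ => Submodule.mem_top, ?_, ?_⟩
    · rw [finrank_top, Module.finrank_zero_of_subsingleton, mul_zero]
    · have h1 : (phiDcris ρv ^ f).charpoly = 1 :=
        Polynomial.eq_one_of_monic_natDegree_zero (LinearMap.charpoly_monic _)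
          (by rw [LinearMap.charpoly_natDegree, Module.finrank_zero_of_subsingleton])
      have h2 : ((phiDcris ρv ^ f).restrict
          (fun x _ => Submodule.mem_top : Set.MapsTo (phiDcris ρv ^ f)
            (⊤ : Submodule (PadicAlgCl p) (Dcris (F := F) (p := p) ρv)) ⊤)).charpoly = 1 :=
        Polynomial.eq_one_of_monic_natDegree_zero (LinearMap.charpoly_monic _)
          (by rw [LinearMap.charpoly_natDegree, finrank_top, Module.finrank_zero_of_subsingleton])
      rw [h1, h2, one_pow]
  · obtain ⟨c, hc⟩ := Module.End.exists_eigenvalue (mulDcris ρv a)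
    obtain ⟨x, hx⟩ := hc.exists_hasEigenvector
    exact ⟨(mulDcris ρv a).eigenspace c, mapsTo_eigenspace_of_comp_eq (phiDcris_pow_comp_mulDcris_of_card ρv hq a) c,
      finrank_Dcris_eq_mul hq ρv hφ ha hx.apply_eq_smul hx.2,
      charpoly_phiDcris_pow_eq_pow hq ρv hφ ha hx.apply_eq_smul hx.2 _⟩

end Dcris

/-! ### §2 `φ` injective on `B_max(F)` ⇒ `φ_D` injective on `D_cris(ρ_v)` -/

section Flat

variable {E : Type*} [Field E] [Algebra ℚ_[p] E] {B : Type*} [CommRing B] [Algebra ℚ_[p] B]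

/-- **`1 ⊗ φ` is injective on `E^m ⊗_{ℚ_p} B` when `φ` is** (`E^m` is flat over the field `ℚ_p`). [folklore] -/
theorem phiTensor_injective (φ : B →ₐ[ℚ_[p]] B) (hφ : Function.Injective φ) :
    Function.Injective (phiTensor (E := E) (m := m) φ) := by
  have h1 : Function.Injective (LinearMap.lTensor (Fin m → E) φ.toLinearMap) :=
    Module.Flat.lTensor_preserves_injective_linearMap _ hφ
  have h2 : (phiTensor (E := E) (m := m) φ).restrictScalars ℚ_[p] = LinearMap.lTensor (Fin m → E) φ.toLinearMap :=
    TensorProduct.ext' fun v b => by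
      simp only [LinearMap.restrictScalars_apply, phiTensor, TensorProduct.AlgebraTensorModule.map_tmul,
        LinearMap.id_apply, LinearMap.lTensor_tmul]
  intro x y hxy
  exact h1 (by rw [← h2]; exact hxy)

end Flat

omit [Fact (¬ IsUnit (p : maxUnramifiedCompletion F))] [CharP (IsLocalRing.ResidueField (maxUnramifiedCompletion F)) p] in
/-- **`φ` injective on `B_max(F)` ⇒ `φ_D` injective on `D_cris(ρ_v)`** — the discharge of the hypothesis of §1
from the published input (Colmez: `φ` is injective on `A_max`, hence on `B_max⁺ = A_max[1/p]` and
`B_max = B_max⁺[1/t]`), which the tree does not yet prove for its constructed `B_max(F)`. [cite: Colmez1998Annals, §III.2] -/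
theorem phiDcris_injective_of_frobBmax_injective (ρv : FramedRep (absoluteGaloisGroup F) (PadicAlgCl p) m)
    (hφ : Function.Injective (frobBmax F p)) : Function.Injective (phiDcris (F := F) (p := p) ρv) := by
  intro x y hxy
  apply Subtype.ext
  have h : phiTensor (E := PadicAlgCl p) (m := m) (frobBmaxAlgHom F p)
      (x : (Fin m → PadicAlgCl p) ⊗[ℚ_[p]] Bmax F p) =
        phiTensor (frobBmaxAlgHom F p) (y : (Fin m → PadicAlgCl p) ⊗[ℚ_[p]] Bmax F p) := by
    rw [← coe_phiDcris, ← coe_phiDcris, hxy]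
  exact phiTensor_injective (frobBmaxAlgHom F p) hφ h

end D2Cris

end Summit.Langlands.Langlands.Theorems
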